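/-
Copyright (c) 2026 the pub-hodgecm-mathlib formalisation cell (harness21).  Prover seat hodgecm-mathlib-F0P3-p02 (g18): line LH3 (closer stub `stub_N9`), organ J,
residual stub (DATUM-INST) «THE SHARED RANK-ONE DATUM EXISTS» (LH3-plan (g3) RULINGS #8 + 2026-09-02T08:25:41Z BY NAME; texts = LH4-p03 (g4) cert v34b∕v5 ∕ skeleton v3.4b-dev).
-/
import Literature.NumberTheory.Automorphic.ArchRankOneJumpZeroCone        -- ★ p850353 (F0P3a-p07 (g16)) (K0±-FORM-TRANSPORT): `exists_hasOneSidedJump_two_sin_mul_orbitalIntegral_of_eq_over`, the Cayley torus point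
import Literature.NumberTheory.Automorphic.ArchRankOneSplitConeMatching    -- ★ p850345 (F0P3a-p05 (g19)) (A0-c): `exists_tendsto_abs_sub_smul_integral_descConj_hypBlockGL_cone`; brings ★ FILE 1∕2 (`torusU`, `hypBlockGL_mem_torusU`, unimodularity)
import Literature.NumberTheory.Automorphic.ArchEndoscopicChartOrbFree      -- ★ (LH2-p04 (g3)): `quotientMeasure_eq_inv_smul_of_eq_smul` (Haar-freeness of the box-normalised quotient measure)
import Literature.MeasureTheory.Group.InvariantQuotientAbelian             -- ★ `isInvInvariant_of_comm` (Haar measure of the abelian torus is inversion invariant)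
import HarnessLib

/-!
# (DATUM-INST) The SHARED RANK-ONE DATUM `(U(J), μ₀, μ₀′, C₁, C₂)` of organ J exists — the residual stub `stub_N9jumpDatum : SharedDatumExistsStatement` of line LH3
# (Rogawski 1990 §8.2; Varadarajan 1989 §6.4; Shelstad 1979 §4; Folland 1995 §2.6)

Topic `NumberTheory/Automorphic`; namespace `Literature.NumberTheory.Automorphic.UnitaryGroup`.  THEOREMS ONLY (no `def`, no instance, no notation, no axiom, no named fact, no
`sorry`); kernel lane `--kind proof --supports stmt-HodgeConjecture-24833`.  Cell `pub/hodgecm-mathlib`, crux H413 (`stmt-HodgeConjecture-24833`), F0∕P3c line LH3 (closer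
stub `stub_N9`, DIRECT ROAD `F0_P3c_StubN9Direct`, organ J `JumpAgreementStatement`, residual split of skeleton v3.4-dev `stub_N9jumpBricks := jumpBricks_of_statements
stub_N9jumpDatum stub_N9jumpHSide stub_N9jumpGSide`): the FIRST residual stub **`stub_N9jumpDatum : SharedDatumExistsStatement`** (LH3-plan (g3) RULINGS #8 «SHARED RANK-ONE
DATUM» + 2026-09-02T08:25:41Z BY NAME, seat F0P3-p02 (g18); texts token-exact = LH4-p03 (g4) cert v34b ∕ datum cert v5 ∕ skeleton v3.4b-dev `SharedDatumExistsStatement`).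
The head **`sharedRankOneDatum_exists`** has EXACTLY the body of `SharedDatumExistsStatement` as its type, so the line pays the stub by `exact sharedRankOneDatum_exists`.

THE MATHEMATICS (RULINGS #8: «both side heads bind the SAME `(μ₀, μ₀′, C₁, C₂)` on the STANDARD rank-one group `U(J)`, `J = Φ₂ = antidiag(1,1)` over `ℂ`, so that the book
constants are the literals `2·I·C₁∕C₂` and `I·C₁∕C₂` and (J-BOOK) is `ring`»).  We must PRODUCE: a Haar measure `μ₀` on `U(J) = U(1,1)` (right invariant: `U(J)` is unimodular,
★ `modularCharacterFun_eq_one_of_eq_over_antidiagonal_two`); the jump constant `C₁ > 0` of the Weyl-normalised ELLIPTIC orbital integrals at the Cayley torus (★ (K0±)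
p850353, Varadarajan §6.4 Thm 23); an invariant Radon measure `μ₀′ ≠ 0` on `U(J) ⧸ T_split` and the limit constant `C₂ > 0` of the `|eˣ − e⁻ˣ|`-normalised HYPERBOLIC orbital
integrals at the centre (★ (A0-c) p850345, Harish-Chandra's `F_f^A`); and the LINK: `μ₀′ = ρ(B_std) • (μ₀ ∕ ρ)` for EVERY Haar `ρ` on the split torus `T = torusU`,
`B_std = {diag(e^{x+iθ}, e^{−x+iθ}) : x ∈ [0,1], θ ∈ [0,2π]}` the image of the PACK-SPEC (δ3) coordinate box.  We take `μ₀ := haar`, fix ONE Haar `ρ₀` on `T` and put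
`μ₀′ := ρ₀(B_std) • (μ₀ ∕ ρ₀)` (★ `quotientMeasure`, Deitmar–Echterhoff Thm. 1.5.3); the LINK at any other `ρ = κ • ρ₀` is Haar uniqueness + ★ `quotientMeasure_eq_inv_smul_of_eq_smul`
(`μ₀ ∕ (κρ₀) = κ⁻¹ • μ₀ ∕ ρ₀`, the `κ`'s cancel).  `μ₀′ ≠ 0` needs `ρ₀(B_std) > 0`: the chart `(x, θ) ↦ diag(e^{x+iθ}, e^{−x+iθ})` is a continuous homomorphism `ℝ × ℝ → T` ONTO `T`
(`x = log|a|`, `θ = arg a` for `t = diag(a, 1∕ā)`; ★ `exists_eq_hypBlockGL_of_coe_eq_diag`'s computation) and `2π`-periodic in `θ`, so `T = ⋃_{n ∈ ℤ} diag(eⁿ, e⁻ⁿ) · B_std` is a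
COUNTABLE union of translates of `B_std`; a Haar-null `B_std` would make `T` null — absurd (`ρ₀(T) > 0`).

* §1 `exists_hypBlockGL_eq_of_mem_torusU` (the split chart is ONTO the torus), `hypBlockGL_zero_zsmul_two_pi` (`2π`-periodicity), `exists_int_mem_boxStd_of_mem_torusU`
  (every torus element is an integer translate of a box element);
* §2 `isCompact_boxStd`, **`measure_boxStd_ne_zero`** (Haar mass of the box is positive, by the countable cover), `measure_boxStd_lt_top`;
* §3 **`sharedRankOneDatum_exists : ‹SharedDatumExistsStatement›`** — `⟨haar, _, _, ρ₀(B_std) • (haar ∕ ρ₀), _, _, C₁, C₂, hC₁, hC₂, hK0, hA0, hlink⟩`.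
HONEST LABEL: HC_CM is proved only modulo the 7 printed citations (2 remaining named inputs: hLiu418 = `stmt-HodgeConjecture-24832`, h413 = `stmt-HodgeConjecture-24833`) until rung 0
closes; count-neutral (organ J bookkeeping: no new analysis — the two constants are the ★ (K0±) and ★ (A0-c) witnesses).

## References
* [Rogawski1990] J. D. Rogawski, *Automorphic Representations of Unitary Groups in Three Variables*, Ann. of Math. Stud. 123 (1990), §8.2 pp. 119–124 (the two rank-one
  singular integrals of `U(1,1)` at the centre and their constants), §3.6 p. 31 (the tori of `U(1,1)`), §1.7 p. 6 (compatible measures).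
* [Varadarajan1989] V. S. Varadarajan, *An Introduction to Harmonic Analysis on Semisimple Lie Groups* (1989), §6.4 Lemma 21, Thms 22–23 (`F_f^B` jump = `F_f^A` value).
* [Shelstad1979] D. Shelstad, *Characters and inner forms of a quasi-split group over ℝ*, Compositio Math. 39 (1979), §4 Lemma 4.3 p. 25.
* [Folland1995] G. B. Folland, *A Course in Abstract Harmonic Analysis* (1995), §2.2 Thm. 2.20 (Haar uniqueness), §2.6 Thm. 2.49, (2.52) (quotient measures).
* [DeitmarEchterhoff2014] A. Deitmar, S. Echterhoff, *Principles of Harmonic Analysis*, 2nd ed. (2014), Thm. 1.5.3.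
-/

set_option autoImplicit false

noncomputable section

namespace Literature.NumberTheory.Automorphic.UnitaryGroup

open _root_.MeasureTheory Measure Set Filter _root_.Topology _root_.Complex
open Literature.NumberTheory.Automorphic.Shelstad1979.StableOrbitalIntegrals Literature.MeasureTheory.Group
open Literature.NumberTheory.Automorphic Literature.NumberTheory.Rogawski1990
open scoped Real MatrixGroups ENNReal NNReal ComplexConjugate

variable {J : Matrix (Fin 2) (Fin 2) ℂ} (hJ : J = (StdForm.antidiagonal 2).over ℂ)

/-! ## §1 The split chart `(x, θ) ↦ diag(e^{x+iθ}, e^{−x+iθ})` is onto the torus, `2π`-periodic in `θ` -/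

include hJ in
/-- **The split chart is ONTO the diagonal torus of `U(Φ₂)(ℂ)`**: every `t ∈ T = torusU` is `diag(e^{x+iθ}, e^{−x+iθ})` (`t = diag(a, b)` with `ā b = 1`; `x = log |a|`,
`θ = arg a`). [cite: Rogawski1990, §3.6 p. 31] -/
theorem exists_hypBlockGL_eq_of_mem_torusU (t : ↥(unitaryGroupOfForm (starRingEnd ℂ) J)) (ht : t ∈ torusU (starRingEnd ℂ) J) :
    ∃ x θ : ℝ, (t : GL (Fin 2) ℂ) = hypBlockGL x θ := by
  obtain ⟨d, hd⟩ := (mem_torusU_iff t).1 ht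
  have hglmat : ((glDiagonal 2 ℂ d : GL (Fin 2) ℂ) : Matrix (Fin 2) (Fin 2) ℂ) = !![((d 0 : ℂˣ) : ℂ), 0; 0, ((d 1 : ℂˣ) : ℂ)] := by
    rw [coe_glDiagonal]
    ext i j
    fin_cases i <;> fin_cases j <;> simp
  have hU : glDiagonal 2 ℂ d ∈ unitaryGroupOfForm (starRingEnd ℂ) J := by rw [hd]; exact t.2
  rw [mem_unitaryGroupOfForm_iff, hJ, StdForm.over_antidiagonal_eq, hglmat] at hU
  have hpq : conj ((d 0 : ℂˣ) : ℂ) * ((d 1 : ℂˣ) : ℂ) = 1 := (diag_mem_unitary_antidiag_iff _ _).1 hU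
  have hp : ((d 0 : ℂˣ) : ℂ) ≠ 0 := (d 0).ne_zero
  -- adapted from ★ `exists_eq_hypBlockGL_of_coe_eq_diag` (ArchEndoscopicChartExhaustion)
  set x : ℝ := Real.log ‖((d 0 : ℂˣ) : ℂ)‖ with hx
  set θ : ℝ := Complex.arg ((d 0 : ℂˣ) : ℂ) with hθ
  have e0 : Complex.exp ((x : ℂ) + (θ : ℂ) * I) = ((d 0 : ℂˣ) : ℂ) := by
    rw [Complex.exp_add, ← Complex.ofReal_exp, Real.exp_log (norm_pos_iff.2 hp)]
    exact Complex.norm_mul_exp_arg_mul_I _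
  have e1 : Complex.exp (-(x : ℂ) + (θ : ℂ) * I) = ((d 1 : ℂˣ) : ℂ) := by
    have hstar : conj ((d 0 : ℂˣ) : ℂ) = Complex.exp ((x : ℂ) - (θ : ℂ) * I) := by
      rw [← e0, ← Complex.exp_conj, map_add, map_mul, Complex.conj_ofReal, Complex.conj_ofReal, Complex.conj_I]
      ring_nf
    have h2 : ((d 1 : ℂˣ) : ℂ) = (conj ((d 0 : ℂˣ) : ℂ))⁻¹ := eq_inv_of_mul_eq_one_right hpq
    rw [h2, hstar, ← Complex.exp_neg]
    congr 1
    ring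
  refine ⟨x, θ, ?_⟩
  rw [← hd]
  refine Matrix.GeneralLinearGroup.ext fun i j => ?_
  rw [hglmat, coe_hypBlockGL]
  fin_cases i <;> fin_cases j
  · simpa using e0.symm
  · simp
  · simp
  · simpa using e1.symm

/-- **`2π`-periodicity of the split chart in the angle**: `diag(e^{i n 2π}, e^{i n 2π}) = 1` (`n ∈ ℤ`). [cite: Rogawski1990, §3.6 p. 31] -/
theorem hypBlockGL_zero_zsmul_two_pi (n : ℤ) : hypBlockGL 0 (n • (2 * π)) = 1 := by
  have h : cexp ((n : ℂ) * (2 * (π : ℂ)) * I) = 1 := by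
    rw [mul_assoc]
    exact Complex.exp_int_mul_two_pi_mul_I n
  refine Matrix.GeneralLinearGroup.ext fun i j => ?_
  rw [coe_hypBlockGL, Units.val_one]
  fin_cases i <;> fin_cases j <;> simp [zsmul_eq_mul, h]

/-- The split chart as a map into the torus is multiplicative: `T(x + x′, θ + θ′) = T(x, θ) · T(x′, θ′)` (★ `hypBlockGL_add`, subtype level). [cite: Rogawski1990, §3.6 p. 31] -/
theorem hypBlockGL_torusU_add (x x' θ θ' : ℝ) :
    (⟨⟨hypBlockGL (x + x') (θ + θ'), hypBlockGL_mem_of_eq_over hJ (x + x') (θ + θ')⟩, hypBlockGL_mem_torusU hJ (x + x') (θ + θ')⟩ : ↥(torusU (starRingEnd ℂ) J)) =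
      (⟨⟨hypBlockGL x θ, hypBlockGL_mem_of_eq_over hJ x θ⟩, hypBlockGL_mem_torusU hJ x θ⟩ : ↥(torusU (starRingEnd ℂ) J)) *
        ⟨⟨hypBlockGL x' θ', hypBlockGL_mem_of_eq_over hJ x' θ'⟩, hypBlockGL_mem_torusU hJ x' θ'⟩ :=
  Subtype.ext (Subtype.ext (hypBlockGL_add x x' θ θ'))

/-- The split chart into the torus is continuous. [cite: Rogawski1990, §3.6 p. 31] -/
theorem continuous_hypBlockGL_torusU :
    Continuous fun p : ℝ × ℝ => (⟨⟨hypBlockGL p.1 p.2, hypBlockGL_mem_of_eq_over hJ p.1 p.2⟩, hypBlockGL_mem_torusU hJ p.1 p.2⟩ : ↥(torusU (starRingEnd ℂ) J)) :=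
  (continuous_hypBlockGL.subtype_mk _).subtype_mk _

include hJ in
/-- **Every torus element is an INTEGER translate of a box element**: `t = T(n, 0) · T(x′, θ′)` with `n ∈ ℤ`, `x′ ∈ [0,1]`, `θ′ ∈ [0, 2π]` (`x = n + x′` by the floor, `θ` reduced
mod `2π` by periodicity). [cite: Rogawski1990, §3.6 p. 31] [cite: Folland1995, §2.2 Thm. 2.20] -/
theorem exists_int_mem_boxStd_of_mem_torusU (t : ↥(torusU (starRingEnd ℂ) J)) :
    ∃ n : ℤ, ((⟨⟨hypBlockGL (n : ℝ) 0, hypBlockGL_mem_of_eq_over hJ (n : ℝ) 0⟩, hypBlockGL_mem_torusU hJ (n : ℝ) 0⟩ : ↥(torusU (starRingEnd ℂ) J)))⁻¹ * t ∈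
      (fun p : ℝ × ℝ => (⟨⟨hypBlockGL p.1 p.2, hypBlockGL_mem_of_eq_over hJ p.1 p.2⟩, hypBlockGL_mem_torusU hJ p.1 p.2⟩ : ↥(torusU (starRingEnd ℂ) J))) ''
        (Set.Icc (0 : ℝ) 1 ×ˢ Set.Icc (0 : ℝ) (2 * π)) := by
  obtain ⟨x, θ, hxθ⟩ := exists_hypBlockGL_eq_of_mem_torusU hJ (t : ↥(unitaryGroupOfForm (starRingEnd ℂ) J)) t.2
  -- `x = ⌊x⌋ + fract x`, `θ = θ′ + k • 2π` with `θ′ ∈ [0, 2π)`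
  have hxdec : x = (⌊x⌋ : ℝ) + Int.fract x := (Int.floor_add_fract x).symm
  have hθdec : θ = toIcoMod Real.two_pi_pos 0 θ + toIcoDiv Real.two_pi_pos 0 θ • (2 * π) := (toIcoMod_add_toIcoDiv_zsmul Real.two_pi_pos 0 θ).symm
  have hθ'mem : toIcoMod Real.two_pi_pos 0 θ ∈ Set.Ico (0 : ℝ) (0 + 2 * π) := toIcoMod_mem_Ico Real.two_pi_pos 0 θ
  refine ⟨⌊x⌋, (Int.fract x, toIcoMod Real.two_pi_pos 0 θ),
    ⟨⟨Int.fract_nonneg x, (Int.fract_lt_one x).le⟩, ⟨hθ'mem.1, by simpa using hθ'mem.2.le⟩⟩, ?_⟩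
  -- `T(n,0)⁻¹ · t = T(fract x, θ′)`
  rw [eq_inv_mul_iff_mul_eq]
  apply Subtype.ext
  apply Subtype.ext
  show hypBlockGL (⌊x⌋ : ℝ) 0 * hypBlockGL (Int.fract x) (toIcoMod Real.two_pi_pos 0 θ) = ((t : ↥(unitaryGroupOfForm (starRingEnd ℂ) J)) : GL (Fin 2) ℂ)
  calc hypBlockGL (⌊x⌋ : ℝ) 0 * hypBlockGL (Int.fract x) (toIcoMod Real.two_pi_pos 0 θ)
      = hypBlockGL ((⌊x⌋ : ℝ) + Int.fract x) (0 + toIcoMod Real.two_pi_pos 0 θ) := (hypBlockGL_add _ _ _ _).symm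
    _ = hypBlockGL x (toIcoMod Real.two_pi_pos 0 θ) := by rw [← hxdec, zero_add]
    _ = hypBlockGL (x + 0) (toIcoMod Real.two_pi_pos 0 θ + toIcoDiv Real.two_pi_pos 0 θ • (2 * π)) := by
          rw [hypBlockGL_add, hypBlockGL_zero_zsmul_two_pi, mul_one]
    _ = hypBlockGL x θ := by rw [add_zero, ← hθdec]
    _ = ((t : ↥(unitaryGroupOfForm (starRingEnd ℂ) J)) : GL (Fin 2) ℂ) := hxθ.symm

/-! ## §2 The standard box `B_std ⊆ T` has positive finite Haar mass -/

/-- `B_std` is compact (continuous image of `[0,1] × [0,2π]`). [cite: Folland1995, §2.6 (2.52)] -/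
theorem isCompact_boxStd :
    IsCompact ((fun p : ℝ × ℝ => (⟨⟨hypBlockGL p.1 p.2, hypBlockGL_mem_of_eq_over hJ p.1 p.2⟩, hypBlockGL_mem_torusU hJ p.1 p.2⟩ : ↥(torusU (starRingEnd ℂ) J))) ''
      (Set.Icc (0 : ℝ) 1 ×ˢ Set.Icc (0 : ℝ) (2 * π))) :=
  (isCompact_Icc.prod isCompact_Icc).image (continuous_hypBlockGL_torusU hJ)

include hJ in
/-- **The standard box has POSITIVE Haar mass**: `T = ⋃_{n ∈ ℤ} T(n,0) · B_std` (§1) is a countable union of left translates, each of the same `ρ`-mass; a null box would make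
`ρ(T) = 0`. [cite: Folland1995, §2.2 Thm. 2.20; §2.6 (2.52)] [cite: Rogawski1990, §1.7 p. 6] -/
theorem measure_boxStd_ne_zero [MeasurableSpace ↥(torusU (starRingEnd ℂ) J)] [BorelSpace ↥(torusU (starRingEnd ℂ) J)]
    (ρ : Measure ↥(torusU (starRingEnd ℂ) J)) [ρ.IsMulLeftInvariant] [ρ.IsOpenPosMeasure] :
    ρ ((fun p : ℝ × ℝ => (⟨⟨hypBlockGL p.1 p.2, hypBlockGL_mem_of_eq_over hJ p.1 p.2⟩, hypBlockGL_mem_torusU hJ p.1 p.2⟩ : ↥(torusU (starRingEnd ℂ) J))) ''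
      (Set.Icc (0 : ℝ) 1 ×ˢ Set.Icc (0 : ℝ) (2 * π))) ≠ 0 := by
  intro h0
  -- the countable cover by integer translates
  have hcover : (Set.univ : Set ↥(torusU (starRingEnd ℂ) J)) ⊆ ⋃ n : ℤ,
      (fun b : ↥(torusU (starRingEnd ℂ) J) =>
          ((⟨⟨hypBlockGL (n : ℝ) 0, hypBlockGL_mem_of_eq_over hJ (n : ℝ) 0⟩, hypBlockGL_mem_torusU hJ (n : ℝ) 0⟩ : ↥(torusU (starRingEnd ℂ) J)))⁻¹ * b) ⁻¹'
        ((fun p : ℝ × ℝ => (⟨⟨hypBlockGL p.1 p.2, hypBlockGL_mem_of_eq_over hJ p.1 p.2⟩, hypBlockGL_mem_torusU hJ p.1 p.2⟩ : ↥(torusU (starRingEnd ℂ) J))) ''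
          (Set.Icc (0 : ℝ) 1 ×ˢ Set.Icc (0 : ℝ) (2 * π))) := by
    intro t _
    obtain ⟨n, hn⟩ := exists_int_mem_boxStd_of_mem_torusU hJ t
    exact Set.mem_iUnion.2 ⟨n, hn⟩
  have hle := (measure_mono (μ := ρ) hcover).trans (measure_iUnion_le (μ := ρ) _)
  simp only [measure_preimage_mul, h0, tsum_zero, nonpos_iff_eq_zero] at hle
  exact (isOpen_univ.measure_ne_zero ρ Set.univ_nonempty) hle

/-- The standard box has FINITE mass for any measure finite on compacts. [cite: Folland1995, §2.6 (2.52)] -/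
theorem measure_boxStd_lt_top [MeasurableSpace ↥(torusU (starRingEnd ℂ) J)]
    (ρ : Measure ↥(torusU (starRingEnd ℂ) J)) [IsFiniteMeasureOnCompacts ρ] :
    ρ ((fun p : ℝ × ℝ => (⟨⟨hypBlockGL p.1 p.2, hypBlockGL_mem_of_eq_over hJ p.1 p.2⟩, hypBlockGL_mem_torusU hJ p.1 p.2⟩ : ↥(torusU (starRingEnd ℂ) J))) ''
      (Set.Icc (0 : ℝ) 1 ×ˢ Set.Icc (0 : ℝ) (2 * π))) < ⊤ :=
  (isCompact_boxStd hJ).measure_lt_top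

/-! ## §3 The shared rank-one datum exists -/

/-- **(DATUM-INST) THE SHARED RANK-ONE DATUM EXISTS** — type = skeleton v3.4b-dev's `SharedDatumExistsStatement` body VERBATIM (LH4-p03 (g4) cert v34b ∕ datum cert v5 texts `SharedK0` ∕ `SharedA0` ∕
`SharedLink`; the split torus carries the SUBTYPE measurable structure, «= (i)» 08:38:28Z): on the standard `U(J)`, `J = Φ₂` over `ℂ`, there are a right-invariant Haar measure `μ₀`, an invariant Radon measure `μ₀′` on `U(J) ⧸ T_split`, and `C₁, C₂ > 0`
with (K0) the elliptic jump `C₁·(cone⁺+cone⁻)` (★ p850353), (A0) the hyperbolic limit `C₂·(cone⁺+cone⁻)` (★ p850345), and (LINK) `μ₀′ = ρ(B_std) • (μ₀ ∕ ρ)` for every Haar `ρ`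
on the torus.  Witnesses: `μ₀ := haar`, `μ₀′ := ρ₀(B_std) • quotientMeasure T ρ₀ _ haar` for one Haar `ρ₀` on `T` (§2: `0 < ρ₀(B_std) < ⊤`), `C₁, C₂` the ★ witnesses; LINK by
Haar uniqueness `ρ = κ • ρ₀` and ★ `quotientMeasure_eq_inv_smul_of_eq_smul`. [cite: Rogawski1990, §8.2 pp. 119–124; §1.7 p. 6] [cite: Varadarajan1989, §6.4 Thm 23]
[cite: Shelstad1979, Lemma 4.3 p. 25] [cite: Folland1995, §2.2 Thm. 2.20; §2.6 Thm. 2.49, (2.52)] [cite: DeitmarEchterhoff2014, Thm. 1.5.3] -/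
theorem sharedRankOneDatum_exists :
  ∀ {J : Matrix (Fin 2) (Fin 2) ℂ} (hJ : J = (StdForm.antidiagonal 2).over ℂ)
    [MeasurableSpace ↥(unitaryGroupOfForm (starRingEnd ℂ) J)] [BorelSpace ↥(unitaryGroupOfForm (starRingEnd ℂ) J)]
    [LocallyCompactSpace ↥(unitaryGroupOfForm (starRingEnd ℂ) J)] [SecondCountableTopology ↥(unitaryGroupOfForm (starRingEnd ℂ) J)]
    [MeasurableSpace (↥(unitaryGroupOfForm (starRingEnd ℂ) J) ⧸ torusU (starRingEnd ℂ) J)] [BorelSpace (↥(unitaryGroupOfForm (starRingEnd ℂ) J) ⧸ torusU (starRingEnd ℂ) J)],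
    ∃ (μ₀ : Measure ↥(unitaryGroupOfForm (starRingEnd ℂ) J)) (_ : μ₀.IsHaarMeasure) (_ : μ₀.IsMulRightInvariant)
      (μ₀' : Measure (↥(unitaryGroupOfForm (starRingEnd ℂ) J) ⧸ torusU (starRingEnd ℂ) J)) (_ : SMulInvariantMeasure ↥(unitaryGroupOfForm (starRingEnd ℂ) J) (↥(unitaryGroupOfForm (starRingEnd ℂ) J) ⧸ torusU (starRingEnd ℂ) J) μ₀') (_ : IsFiniteMeasureOnCompacts μ₀')
      (C₁ C₂ : ℝ), 0 < C₁ ∧ 0 < C₂ ∧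
      (∀ (f : Matrix (Fin 2) (Fin 2) ℂ → ℂ), Continuous f → HasCompactSupport f → ∀ z : Circle,
        HasOneSidedJump (fun ψ : ℝ => (2 * Real.sin ψ : ℂ) *
            ∫ h : ↥(unitaryGroupOfForm (starRingEnd ℂ) J),
              f (((h * ⟨Matrix.GeneralLinearGroup.mkOfDetNeZero !![(1 : ℂ), 1; 1, -1] det_cayleyTwo_ne_zero *
                    circleDiagonal 2 ![z * Circle.exp ψ, z * Circle.exp (-ψ)] *
                    (Matrix.GeneralLinearGroup.mkOfDetNeZero !![(1 : ℂ), 1; 1, -1] det_cayleyTwo_ne_zero)⁻¹,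
                  cayley_conj_circleDiagonal_mem_of_eq_over hJ _⟩ * h⁻¹ :
                ↥(unitaryGroupOfForm (starRingEnd ℂ) J)) : GL (Fin 2) ℂ) : Matrix (Fin 2) (Fin 2) ℂ) ∂μ₀)
          ((C₁ : ℂ) * ((∫ p in Ioi (0 : ℝ) ×ˢ Ioc (0 : ℝ) (2 * π),
              f ((!![(1 : ℂ), 1; 1, -1] : Matrix (Fin 2) (Fin 2) ℂ) *
                ((z : ℂ) • (1 : Matrix (Fin 2) (Fin 2) ℂ) + p.1 • Matrix.diagonal ![(z : ℂ) * I, -((z : ℂ) * I)] +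
                  p.1 • !![(0 : ℂ), -((z : ℂ) * I) * cexp (-((p.2 : ℂ) * I)); ((z : ℂ) * I) * cexp ((p.2 : ℂ) * I), 0]) *
                !![(1 / 2 : ℂ), 1 / 2; 1 / 2, -(1 / 2)])) +
            ∫ p in Ioi (0 : ℝ) ×ˢ Ioc (0 : ℝ) (2 * π),
              f ((!![(1 : ℂ), 1; 1, -1] : Matrix (Fin 2) (Fin 2) ℂ) *
                ((z : ℂ) • (1 : Matrix (Fin 2) (Fin 2) ℂ) + p.1 • Matrix.diagonal ![-((z : ℂ) * I), (z : ℂ) * I] +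
                  p.1 • !![(0 : ℂ), ((z : ℂ) * I) * cexp (-((p.2 : ℂ) * I)); -((z : ℂ) * I) * cexp ((p.2 : ℂ) * I), 0]) *
                !![(1 / 2 : ℂ), 1 / 2; 1 / 2, -(1 / 2)])))) ∧
      (∀ (f : Matrix (Fin 2) (Fin 2) ℂ → ℂ), Continuous f → HasCompactSupport f → ∀ θ : ℝ,
      Tendsto (fun x : ℝ => |Real.exp x - Real.exp (-x)| •
          ∫ y, descConj (⟨hypBlockGL x θ, hypBlockGL_mem_of_eq_over hJ x θ⟩ : ↥(unitaryGroupOfForm (starRingEnd ℂ) J)) (torusU (starRingEnd ℂ) J)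
            (LineRing.forall_mem_torusU_comm (starRingEnd ℂ) J (hypBlockGL_mem_torusU hJ x θ))
            (fun g : ↥(unitaryGroupOfForm (starRingEnd ℂ) J) => f ((g : GL (Fin 2) ℂ) : Matrix (Fin 2) (Fin 2) ℂ)) y ∂μ₀')
        (𝓝[≠] 0)
        (𝓝 (C₂ • ((∫ p in Ioi (0 : ℝ) ×ˢ Ioc (0 : ℝ) (2 * π),
            f ((!![(1 : ℂ), 1; 1, -1] : Matrix (Fin 2) (Fin 2) ℂ) *
              (Complex.exp ((θ : ℂ) * Complex.I) • (1 : Matrix (Fin 2) (Fin 2) ℂ) +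
                p.1 • Matrix.diagonal ![Complex.exp ((θ : ℂ) * Complex.I) * Complex.I, -(Complex.exp ((θ : ℂ) * Complex.I) * Complex.I)] +
                p.1 • !![(0 : ℂ), -(Complex.exp ((θ : ℂ) * Complex.I) * Complex.I) * Complex.exp (-((p.2 : ℂ) * Complex.I));
                  (Complex.exp ((θ : ℂ) * Complex.I) * Complex.I) * Complex.exp ((p.2 : ℂ) * Complex.I), 0]) *
              !![(1 / 2 : ℂ), 1 / 2; 1 / 2, -(1 / 2)])) +
          ∫ p in Ioi (0 : ℝ) ×ˢ Ioc (0 : ℝ) (2 * π),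
            f ((!![(1 : ℂ), 1; 1, -1] : Matrix (Fin 2) (Fin 2) ℂ) *
              (Complex.exp ((θ : ℂ) * Complex.I) • (1 : Matrix (Fin 2) (Fin 2) ℂ) +
                p.1 • Matrix.diagonal ![-(Complex.exp ((θ : ℂ) * Complex.I) * Complex.I), Complex.exp ((θ : ℂ) * Complex.I) * Complex.I] +
                p.1 • !![(0 : ℂ), (Complex.exp ((θ : ℂ) * Complex.I) * Complex.I) * Complex.exp (-((p.2 : ℂ) * Complex.I));
                  -(Complex.exp ((θ : ℂ) * Complex.I) * Complex.I) * Complex.exp ((p.2 : ℂ) * Complex.I), 0]) *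
              !![(1 / 2 : ℂ), 1 / 2; 1 / 2, -(1 / 2)]))))) ∧
      (∀ (ρ : Measure ↥(torusU (starRingEnd ℂ) J)) [ρ.IsHaarMeasure] [ρ.IsInvInvariant],
    μ₀' = ρ ((fun p : ℝ × ℝ =>
        (⟨⟨hypBlockGL p.1 p.2, hypBlockGL_mem_of_eq_over hJ p.1 p.2⟩, hypBlockGL_mem_torusU hJ p.1 p.2⟩ : ↥(torusU (starRingEnd ℂ) J))) ''
          (Set.Icc (0 : ℝ) 1 ×ˢ Set.Icc (0 : ℝ) (2 * π))) •
      quotientMeasure (torusU (starRingEnd ℂ) J) ρ (LineRing.isClosed_torusU_two (starRingEnd ℂ) J) μ₀) := by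
  intro J hJ _ _ _ _ _ _
  haveI : Fact (0 < 2 * π) := ⟨Real.two_pi_pos⟩
  haveI hT : IsClosed (torusU (starRingEnd ℂ) J : Set ↥(unitaryGroupOfForm (starRingEnd ℂ) J)) := LineRing.isClosed_torusU_two (starRingEnd ℂ) J
  haveI : LocallyCompactSpace ↥(torusU (starRingEnd ℂ) J) := hT.isClosedEmbedding_subtypeVal.locallyCompactSpace
  haveI : SecondCountableTopology ↥(torusU (starRingEnd ℂ) J) := TopologicalSpace.Subtype.secondCountableTopology _
  -- the shared Haar measure on `U(J)` (unimodular)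
  obtain ⟨μ₀, hμ₀⟩ : ∃ μ₀ : Measure ↥(unitaryGroupOfForm (starRingEnd ℂ) J), μ₀.IsHaarMeasure := ⟨Measure.haar, inferInstance⟩
  haveI : μ₀.IsMulRightInvariant := isMulRightInvariant_of_modularCharacterFun_eq_one (modularCharacterFun_eq_one_of_eq_over_antidiagonal_two hJ) μ₀
  -- (K0): the elliptic jump constant
  obtain ⟨C₁, hC₁, hK0⟩ := exists_hasOneSidedJump_two_sin_mul_orbitalIntegral_of_eq_over hJ μ₀
  -- one Haar measure on the (abelian) split torus
  obtain ⟨ρ₀, hρ₀⟩ : ∃ ρ₀ : Measure ↥(torusU (starRingEnd ℂ) J), ρ₀.IsHaarMeasure := ⟨Measure.haar, inferInstance⟩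
  haveI : ρ₀.IsInvInvariant := isInvInvariant_of_comm _ hT (fun x hx y hy => LineRing.forall_mem_torusU_comm (starRingEnd ℂ) J hy x hx) ρ₀
  have hB0 := measure_boxStd_ne_zero hJ ρ₀
  have hBtop := measure_boxStd_lt_top hJ ρ₀
  -- the box-normalised quotient measure
  set μ₀' : Measure (↥(unitaryGroupOfForm (starRingEnd ℂ) J) ⧸ torusU (starRingEnd ℂ) J) :=
    ρ₀ ((fun p : ℝ × ℝ => (⟨⟨hypBlockGL p.1 p.2, hypBlockGL_mem_of_eq_over hJ p.1 p.2⟩, hypBlockGL_mem_torusU hJ p.1 p.2⟩ : ↥(torusU (starRingEnd ℂ) J))) ''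
        (Set.Icc (0 : ℝ) 1 ×ˢ Set.Icc (0 : ℝ) (2 * π))) •
      quotientMeasure (torusU (starRingEnd ℂ) J) ρ₀ (LineRing.isClosed_torusU_two (starRingEnd ℂ) J) μ₀ with hμ₀'
  haveI hsm : SMulInvariantMeasure ↥(unitaryGroupOfForm (starRingEnd ℂ) J) (↥(unitaryGroupOfForm (starRingEnd ℂ) J) ⧸ torusU (starRingEnd ℂ) J) μ₀' := by
    rw [hμ₀']; infer_instance
  haveI hfin : IsFiniteMeasureOnCompacts μ₀' := by
    rw [hμ₀']; exact IsFiniteMeasureOnCompacts.smul _ hBtop.ne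
  have hne : μ₀' ≠ 0 := by
    intro h
    have h1 := congrArg (fun m : Measure (↥(unitaryGroupOfForm (starRingEnd ℂ) J) ⧸ torusU (starRingEnd ℂ) J) => m Set.univ) h
    simp only [hμ₀', Measure.smul_apply, smul_eq_mul, Measure.coe_zero, Pi.zero_apply, mul_eq_zero] at h1
    rcases h1 with h1 | h1
    · exact hB0 h1
    · exact quotientMeasure_ne_zero (torusU (starRingEnd ℂ) J) ρ₀ (LineRing.isClosed_torusU_two (starRingEnd ℂ) J) μ₀ (Measure.measure_univ_eq_zero.1 h1)
  -- (A0): the hyperbolic limit constant on `μ₀′`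
  obtain ⟨C₂, hC₂, hA0⟩ := exists_tendsto_abs_sub_smul_integral_descConj_hypBlockGL_cone hJ μ₀' hne (E := ℂ)
  refine ⟨μ₀, hμ₀, inferInstance, μ₀', hsm, hfin, C₁, C₂, hC₁, hC₂, hK0, hA0, fun ρ _ _ => ?_⟩
  -- (LINK): Haar uniqueness on the torus, `ρ = κ • ρ₀`, and Haar-freeness of the normalised quotient measure
  have hρ : ρ = haarScalarFactor ρ ρ₀ • ρ₀ := isMulLeftInvariant_eq_smul ρ ρ₀
  have hκ : haarScalarFactor ρ ρ₀ ≠ 0 := (haarScalarFactor_pos_of_isHaarMeasure ρ ρ₀).ne'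
  have hq := quotientMeasure_eq_inv_smul_of_eq_smul (torusU (starRingEnd ℂ) J) (LineRing.isClosed_torusU_two (starRingEnd ℂ) J) ρ₀ ρ μ₀ hκ hρ
  have hBρ : ρ ((fun p : ℝ × ℝ => (⟨⟨hypBlockGL p.1 p.2, hypBlockGL_mem_of_eq_over hJ p.1 p.2⟩, hypBlockGL_mem_torusU hJ p.1 p.2⟩ : ↥(torusU (starRingEnd ℂ) J))) ''
        (Set.Icc (0 : ℝ) 1 ×ˢ Set.Icc (0 : ℝ) (2 * π))) =
      (haarScalarFactor ρ ρ₀ : ℝ≥0∞) *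
        ρ₀ ((fun p : ℝ × ℝ => (⟨⟨hypBlockGL p.1 p.2, hypBlockGL_mem_of_eq_over hJ p.1 p.2⟩, hypBlockGL_mem_torusU hJ p.1 p.2⟩ : ↥(torusU (starRingEnd ℂ) J))) ''
          (Set.Icc (0 : ℝ) 1 ×ˢ Set.Icc (0 : ℝ) (2 * π))) := by
    calc _ = (haarScalarFactor ρ ρ₀ • ρ₀) ((fun p : ℝ × ℝ => (⟨⟨hypBlockGL p.1 p.2, hypBlockGL_mem_of_eq_over hJ p.1 p.2⟩, hypBlockGL_mem_torusU hJ p.1 p.2⟩ :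
          ↥(torusU (starRingEnd ℂ) J))) '' (Set.Icc (0 : ℝ) 1 ×ˢ Set.Icc (0 : ℝ) (2 * π))) := by rw [← hρ]
      _ = _ := Measure.coe_nnreal_smul_apply _ _ _
  rw [hq, hBρ, ENNReal.smul_def, smul_smul, hμ₀']
  congr 1
  rw [ENNReal.coe_inv hκ, mul_comm (haarScalarFactor ρ ρ₀ : ℝ≥0∞) _, mul_assoc, ENNReal.mul_inv_cancel (ENNReal.coe_ne_zero.2 hκ) ENNReal.coe_ne_top,
    mul_one]

end Literature.NumberTheory.Automorphic.UnitaryGroup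

end
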